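import Mathlib.Analysis.Fourier.FiniteAbelian.PontryaginDuality
import Mathlib.Analysis.SpecialFunctions.Complex.Circle
import Mathlib.GroupTheory.Index
import Literature.Computability.Cryptography.KitaevPhaseEstimationSums
import HarnessLib

/-!
# Box character sums over the cosets of a lattice: the Poisson identity

Topic `Computability/Cryptography` (harmonic analysis of period finding over `ℤ^T`); theorem-only file, no named facts.

Fourier sampling of a function on the box `[0, M)^T ⊂ ℤ^T` that is constant on the cosets of a finite-index subgroup
`Λ ≤ ℤ^T` (the hidden-subgroup problem over `ℤ^T` with a box cut-off, as in Hallgren's class-group algorithm) leads to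
the quantity `∑_{g ∈ ℤ^T/Λ} |∑_{e ∈ box ∩ g} e(θ·e)|²` at the frequency `θ ∈ ℝ^T`. Summing over ALL cosets restores
the full box and makes the sum EXACTLY computable:

* `sum_norm_sq_boxSum_eq_sum_pairs` — it equals the pair sum `∑_{e, e' ∈ box} [e − e' ∈ Λ] e(θ·(e − e'))`;
* `sum_norm_sq_boxSum_eq` — **the Poisson identity**: it equals
  `(1/[ℤ^T : Λ]) ∑_{χ ∈ (ℤ^T/Λ)^} ∏_i |∑_{x<M} e(θ_i x) χ(ē_i)^x|²`, a uniform MIXTURE over the dual group of PRODUCTS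
  of one-dimensional Fejér-type kernels (orthogonality of the characters of the finite group `ℤ^T/Λ`).

So the measured frequency vector of such an experiment is exactly: a uniformly random dual element, plus
independent one-dimensional Shor/Fejér noise in every coordinate — the multi-dimensional box cut-off costs nothing.

## References

* S. Hallgren, *Fast quantum algorithms for computing the unit group and class group of a number field*, STOC 2005,
  §4 (HSP over `ℤ^k`). [Hallgren2005]
* A. Yu. Kitaev, arXiv:quant-ph/9511026 (1995), §4. [Kitaev1995]
-/

noncomputable section

namespace Literature.Computability.Cryptography

namespace PeriodFinding

open Complex Finset

variable {T : ℕ}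

/-- The box `[0, M)^T`. [folklore] -/
abbrev boxT (T M : ℕ) : Finset (Fin T → ℕ) := Fintype.piFinset fun _ : Fin T => range M

/-- A box point as an integer vector. [folklore] -/
abbrev toZ (e : Fin T → ℕ) : Fin T → ℤ := fun i => (e i : ℤ)

/-- The character `e(θ·v) = exp(2πi ∑ θ_i v_i)` of `ℤ^T` at the real frequency `θ`. [folklore] -/
def eR (θ : Fin T → ℝ) (v : Fin T → ℤ) : ℂ := cexp (2 * Real.pi * I * ((∑ i, θ i * (v i : ℝ) : ℝ) : ℂ))

/-- The one-dimensional character value `e(t x) = exp(2πi t x)`. [folklore] -/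
def e1 (t : ℝ) (x : ℕ) : ℂ := cexp (2 * Real.pi * I * ((t * (x : ℝ) : ℝ) : ℂ))

/-- `e(θ·v)` is a character: `e(θ·(v − w)) = e(θ·v) · conj e(θ·w)`. [folklore] -/
theorem eR_sub (θ : Fin T → ℝ) (v w : Fin T → ℤ) : eR θ (v - w) = eR θ v * (starRingEnd ℂ) (eR θ w) := by
  unfold eR
  rw [← Complex.exp_conj, ← Complex.exp_add]
  congr 1
  simp only [map_mul, Complex.conj_ofReal, Complex.conj_I, map_ofNat, Pi.sub_apply, Int.cast_sub]
  have : (∑ i, θ i * ((v i : ℝ) - (w i : ℝ)) : ℝ) = (∑ i, θ i * (v i : ℝ)) - ∑ i, θ i * (w i : ℝ) := by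
    rw [← sum_sub_distrib]; exact sum_congr rfl fun i _ => by ring
  rw [this]
  push_cast
  ring

/-- `e(θ·e)` factorises over the coordinates of a box point. [folklore] -/
theorem eR_toZ_eq_prod (θ : Fin T → ℝ) (e : Fin T → ℕ) : eR θ (toZ e) = ∏ i, e1 (θ i) (e i) := by
  unfold eR e1 toZ
  rw [← Complex.exp_sum]
  congr 1
  push_cast
  rw [mul_sum]

/-- An additive character turns sums into products. [folklore] -/
theorem addChar_map_sum {A : Type*} [AddCommGroup A] (ψ : AddChar A ℂ) {ι : Type*} (s : Finset ι) (x : ι → A) :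
    ψ (∑ i ∈ s, x i) = ∏ i ∈ s, ψ (x i) := by
  classical
  induction s using Finset.induction_on with
  | empty => simp
  | insert a s ha ih => rw [Finset.sum_insert ha, Finset.prod_insert ha, AddChar.map_add_eq_mul, ih]

section Lattice

variable (Λ : AddSubgroup (Fin T → ℤ))

open Classical in
/-- **The sum over cosets of the squared box character sums is a pair sum**:
`∑_g |∑_{e ∈ box, ē = g} e(θ·e)|² = ∑_{e,e' ∈ box} [e − e' ∈ Λ] e(θ·(e − e'))`. [folklore] -/
theorem sum_norm_sq_boxSum_eq_sum_pairs [Fintype ((Fin T → ℤ) ⧸ Λ)] [DecidableEq ((Fin T → ℤ) ⧸ Λ)]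
    (M : ℕ) (θ : Fin T → ℝ) :
    (∑ g : (Fin T → ℤ) ⧸ Λ, ((‖∑ e ∈ (boxT T M).filter (fun e => (QuotientAddGroup.mk (toZ e) : (Fin T → ℤ) ⧸ Λ) = g),
        eR θ (toZ e)‖ : ℝ) : ℂ) ^ 2) =
      ∑ e ∈ boxT T M, ∑ e' ∈ boxT T M, if toZ e - toZ e' ∈ Λ then eR θ (toZ e - toZ e') else 0 := by
  classical
  have step : ∀ g : (Fin T → ℤ) ⧸ Λ,
      ((‖∑ e ∈ (boxT T M).filter (fun e => (QuotientAddGroup.mk (toZ e) : (Fin T → ℤ) ⧸ Λ) = g), eR θ (toZ e)‖ : ℝ) : ℂ) ^ 2 =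
      ∑ e ∈ (boxT T M).filter (fun e => (QuotientAddGroup.mk (toZ e) : (Fin T → ℤ) ⧸ Λ) = g), ∑ e' ∈ boxT T M,
        if toZ e - toZ e' ∈ Λ then eR θ (toZ e - toZ e') else 0 := by
    intro g
    rw [← Complex.ofReal_pow, Kitaev1995.ofReal_norm_sq_sum]
    refine sum_congr rfl fun e he => ?_
    rw [sum_filter]
    refine sum_congr rfl fun e' _ => ?_
    have hge : (QuotientAddGroup.mk (toZ e) : (Fin T → ℤ) ⧸ Λ) = g := (mem_filter.1 he).2
    by_cases h : toZ e - toZ e' ∈ Λ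
    · have : (QuotientAddGroup.mk (toZ e') : (Fin T → ℤ) ⧸ Λ) = g := by
        rw [← hge, eq_comm, QuotientAddGroup.eq]
        have : -toZ e + toZ e' = -(toZ e - toZ e') := by abel
        rw [this]; exact Λ.neg_mem h
      rw [if_pos this, if_pos h, eR_sub]
    · have : (QuotientAddGroup.mk (toZ e') : (Fin T → ℤ) ⧸ Λ) ≠ g := by
        rw [← hge, Ne, eq_comm, QuotientAddGroup.eq]
        intro h'
        apply h
        have : toZ e - toZ e' = -(-toZ e + toZ e') := by abel
        rw [this]; exact Λ.neg_mem h'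
      rw [if_neg this, if_neg h]
  rw [sum_congr rfl fun g _ => step g,
    sum_fiberwise (boxT T M) (fun e => (QuotientAddGroup.mk (toZ e) : (Fin T → ℤ) ⧸ Λ))
      (fun e => ∑ e' ∈ boxT T M, if toZ e - toZ e' ∈ Λ then eR θ (toZ e - toZ e') else 0)]

/-- **The Poisson identity for box character sums over the cosets of a lattice.** For a subgroup `Λ ≤ ℤ^T` of finite
index and any real frequency `θ`:
`∑_{g ∈ ℤ^T/Λ} |∑_{e ∈ [0,M)^T, ē = g} e(θ·e)|² = (1/[ℤ^T:Λ]) ∑_{χ} ∏_i |∑_{x<M} e(θ_i x) χ(ē_i)^x|²`,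
the sum over the characters `χ` of the finite group `ℤ^T/Λ` (`ē_i` the class of the `i`-th unit vector). Proof: both
sides equal the pair sum of `sum_norm_sq_boxSum_eq_sum_pairs`, the right one by expanding the products
(`e(θ·e) ∏ χ(ē_i)^{e_i} = e(θ·e) χ(ē)`) and the orthogonality `∑_χ χ(a) = [ℤ^T:Λ]·[a = 0]` (Mathlib
`AddChar.sum_apply_eq_ite`). [cite: Hallgren2005, §4] -/
theorem sum_norm_sq_boxSum_eq [Fintype ((Fin T → ℤ) ⧸ Λ)] [DecidableEq ((Fin T → ℤ) ⧸ Λ)] (M : ℕ) (θ : Fin T → ℝ) :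
    (∑ g : (Fin T → ℤ) ⧸ Λ, ‖∑ e ∈ (boxT T M).filter (fun e => (QuotientAddGroup.mk (toZ e) : (Fin T → ℤ) ⧸ Λ) = g),
        eR θ (toZ e)‖ ^ 2 : ℝ) =
      (1 / (Λ.index : ℝ)) * ∑ χ : AddChar ((Fin T → ℤ) ⧸ Λ) ℂ,
        ∏ i : Fin T, ‖∑ x ∈ range M, e1 (θ i) x * χ (QuotientAddGroup.mk (Pi.single i 1)) ^ x‖ ^ 2 := by
  classical
  apply Complex.ofReal_injective
  rw [Complex.ofReal_mul (1 / (Λ.index : ℝ))]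
  simp only [Complex.ofReal_sum, Complex.ofReal_prod, Complex.ofReal_pow, Complex.ofReal_div, Complex.ofReal_one,
    Complex.ofReal_natCast]
  rw [sum_norm_sq_boxSum_eq_sum_pairs Λ M θ]
  set G := (Fin T → ℤ) ⧸ Λ
  have hidx : (Λ.index : ℂ) = Fintype.card G := by
    rw [AddSubgroup.index_eq_card, Nat.card_eq_fintype_card]
  have hidx0 : (Λ.index : ℂ) ≠ 0 := by
    rw [hidx]; exact_mod_cast Fintype.card_ne_zero
  -- the coordinate factors of a box point recombine: `∏ e(θ_i e_i) χ(ē_i)^{e_i} = e(θ·e) χ(ē)`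
  have hchar : ∀ (χ : AddChar G ℂ) (e : Fin T → ℕ),
      (∏ i : Fin T, e1 (θ i) (e i) * χ (QuotientAddGroup.mk (Pi.single i 1)) ^ (e i)) =
        eR θ (toZ e) * χ (QuotientAddGroup.mk (toZ e)) := by
    intro χ e
    rw [prod_mul_distrib, ← eR_toZ_eq_prod]
    congr 1
    have : toZ e = ∑ i : Fin T, (e i) • (Pi.single i (1 : ℤ) : Fin T → ℤ) := by
      ext j
      simp [toZ, Finset.sum_apply, Pi.single_apply]
    rw [this]
    show ∏ x, χ ((QuotientAddGroup.mk' Λ) (Pi.single x 1)) ^ e x =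
      χ ((QuotientAddGroup.mk' Λ) (∑ i, e i • (Pi.single i (1 : ℤ) : Fin T → ℤ)))
    rw [map_sum, addChar_map_sum]
    refine prod_congr rfl fun i _ => ?_
    rw [map_nsmul, AddChar.map_nsmul_eq_pow]
  -- expand `∏_i |∑_x …|²` into the pair sum twisted by `χ`
  have hRHS : ∀ χ : AddChar G ℂ,
      (∏ i : Fin T, ((‖∑ x ∈ range M, e1 (θ i) x * χ (QuotientAddGroup.mk (Pi.single i 1)) ^ x‖ : ℝ) : ℂ) ^ 2) =
      ∑ e ∈ boxT T M, ∑ e' ∈ boxT T M, eR θ (toZ e - toZ e') * χ (QuotientAddGroup.mk (toZ e - toZ e')) := by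
    intro χ
    have hsq : ∀ i : Fin T, ((‖∑ x ∈ range M, e1 (θ i) x * χ (QuotientAddGroup.mk (Pi.single i 1)) ^ x‖ : ℝ) : ℂ) ^ 2 =
        (∑ x ∈ range M, e1 (θ i) x * χ (QuotientAddGroup.mk (Pi.single i 1)) ^ x) *
          (starRingEnd ℂ) (∑ x ∈ range M, e1 (θ i) x * χ (QuotientAddGroup.mk (Pi.single i 1)) ^ x) := by
      intro i
      rw [← Complex.ofReal_pow, ← Complex.normSq_eq_norm_sq, ← Complex.mul_conj]
    simp_rw [hsq]
    rw [prod_mul_distrib]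
    have hbox : ∀ f : Fin T → ℕ → ℂ, (∏ i : Fin T, ∑ x ∈ range M, f i x) = ∑ e ∈ boxT T M, ∏ i, f i (e i) := fun f =>
      prod_univ_sum (fun _ : Fin T => range M) f
    rw [hbox, ← map_prod, hbox, map_sum, sum_mul_sum]
    refine sum_congr rfl fun e _ => sum_congr rfl fun e' _ => ?_
    rw [hchar χ e, hchar χ e', map_mul, eR_sub, QuotientAddGroup.mk_sub, AddChar.map_sub_eq_div,
      ← AddChar.map_neg_eq_conj, AddChar.map_neg_eq_inv, div_eq_mul_inv]
    ring
  rw [sum_congr rfl fun χ _ => hRHS χ]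
  -- swap the sums and apply orthogonality of characters
  have hswap : (∑ χ : AddChar G ℂ, ∑ e ∈ boxT T M, ∑ e' ∈ boxT T M,
        eR θ (toZ e - toZ e') * χ (QuotientAddGroup.mk (toZ e - toZ e'))) =
      ∑ e ∈ boxT T M, ∑ e' ∈ boxT T M,
        eR θ (toZ e - toZ e') * ∑ χ : AddChar G ℂ, χ (QuotientAddGroup.mk (toZ e - toZ e')) := by
    rw [sum_comm]
    refine sum_congr rfl fun e _ => ?_
    rw [sum_comm]
    refine sum_congr rfl fun e' _ => ?_
    rw [mul_sum]
  rw [hswap, mul_sum]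
  refine sum_congr rfl fun e _ => ?_
  rw [mul_sum]
  refine sum_congr rfl fun e' _ => ?_
  rw [AddChar.sum_apply_eq_ite, ← hidx]
  have hmem : toZ e - toZ e' ∈ Λ ↔ (QuotientAddGroup.mk (toZ e - toZ e') : G) = 0 :=
    (QuotientAddGroup.eq_zero_iff _).symm
  by_cases h : toZ e - toZ e' ∈ Λ
  · rw [if_pos h, if_pos (hmem.1 h)]
    field_simp
  · rw [if_neg h, if_neg (fun h' => h (hmem.2 h'))]
    simp only [mul_zero]

end Lattice

end PeriodFinding

end Literature.Computability.Cryptography
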